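import Mathlib
import Summits.Ventures.PercRepro2.TwoHullMasterBlocks
import Summits.Ventures.PercRepro2.TwoHullMasterGlue2

/-!
# Cube covers across a two-vertex cut `{l, h}` (blind cell PercRepro2, night-4 g40, 2026-08-29;
proofs/NIGHT4-G40.md §11)

The cube-cover property is closed under PARALLEL composition: if both sides of a two-vertex cut
`{l, h}` (`Glue2.IsGluing2`) carry cube covers whose blocks all mirror the hull pair of `l` at the
antipode (`LMirror`), the glued graph carries one — the blocks are the products `pt₁ b₁ × pt₂ b₂`
on the cube `ι₁ b₁ ⊕ ι₂ b₂` (`prodPt`), since on `U` the hull pairs of the glued graph are the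
unions of the side pairs (`hullPair_glue2_l`, `hullPair_glue2_h`) and the pair order, the
antipode and injectivity all pass to the product.  **`cubeCover_glue2`**; the same with every
block mirroring the hull pair of `h` (`HMirror`, `cubeCover_glue2_h`).  Together with the
certificates of TwoHullMasterPrism.lean this is the first closure theorem of the cube-cover
conjecture (TwoHullMasterCubeConjecture.lean).
-/

namespace Summit.Ventures.PercRepro2

namespace Blocks

open Hull LocRows Path2 Glue2

open scoped Classical

variable {V : Type*} {E₁ E₂ : Type*} {ends₁ : E₁ → Sym2 V} {ends₂ : E₂ → Sym2 V} {l h : V}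
  {V₁ V₂ : Set V}

/-- A family of blocks all of which mirror the hull pair of `l` at the antipode. -/
def LMirror (ends : E₁ → Sym2 V) (l : V) {β : Type*} {ι : β → Type*}
    (pt : ∀ b, (ι b → Bool) → Config E₁) : Prop :=
  ∀ b ε, hullPair ends (pt b (cubeNot ε)) l = (hullPair ends (pt b ε) l).swap

/-- A family of blocks all of which mirror the hull pair of `h` at the antipode. -/
def HMirror (ends : E₁ → Sym2 V) (h : V) {β : Type*} {ι : β → Type*}
    (pt : ∀ b, (ι b → Bool) → Config E₁) : Prop :=
  ∀ b ε, hullPair ends (pt b (cubeNot ε)) h = (hullPair ends (pt b ε) h).swap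

variable {β₁ β₂ : Type*} {ι₁ : β₁ → Type*} {ι₂ : β₂ → Type*}
  {pt₁ : ∀ b, (ι₁ b → Bool) → Config E₁} {pt₂ : ∀ b, (ι₂ b → Bool) → Config E₂}

/-- The product block: the first side at the `inl` coordinates, the second at the `inr` ones. -/
def prodPt (pt₁ : ∀ b, (ι₁ b → Bool) → Config E₁) (pt₂ : ∀ b, (ι₂ b → Bool) → Config E₂)
    (b : β₁ × β₂) (ε : ι₁ b.1 ⊕ ι₂ b.2 → Bool) : Config (E₁ ⊕ E₂) :=
  pair2 (pt₁ b.1 (ε ∘ Sum.inl)) (pt₂ b.2 (ε ∘ Sum.inr))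

/-- The first side of a product point. -/
lemma prodPt_inl (b : β₁ × β₂) (ε : ι₁ b.1 ⊕ ι₂ b.2 → Bool) :
    prodPt pt₁ pt₂ b ε ∘ Sum.inl = pt₁ b.1 (ε ∘ Sum.inl) := rfl

/-- The second side of a product point. -/
lemma prodPt_inr (b : β₁ × β₂) (ε : ι₁ b.1 ⊕ ι₂ b.2 → Bool) :
    prodPt pt₁ pt₂ b ε ∘ Sum.inr = pt₂ b.2 (ε ∘ Sum.inr) := rfl

/-- The order of the sum cube restricts to the summands. -/
lemma comp_inl_le {ι₁ ι₂ : Type*} {ε ε' : ι₁ ⊕ ι₂ → Bool} (hle : ε ≤ ε') :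
    ε ∘ Sum.inl ≤ ε' ∘ Sum.inl := fun j => hle (Sum.inl j)

/-- The order of the sum cube restricts to the summands. -/
lemma comp_inr_le {ι₁ ι₂ : Type*} {ε ε' : ι₁ ⊕ ι₂ → Bool} (hle : ε ≤ ε') :
    ε ∘ Sum.inr ≤ ε' ∘ Sum.inr := fun j => hle (Sum.inr j)

/-- The antipode of the sum cube restricts to the antipodes. -/
lemma cubeNot_comp_inl {ι₁ ι₂ : Type*} (ε : ι₁ ⊕ ι₂ → Bool) :
    cubeNot ε ∘ Sum.inl = cubeNot (ε ∘ Sum.inl) := rfl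

/-- The antipode of the sum cube restricts to the antipodes. -/
lemma cubeNot_comp_inr {ι₁ ι₂ : Type*} (ε : ι₁ ⊕ ι₂ → Bool) :
    cubeNot ε ∘ Sum.inr = cubeNot (ε ∘ Sum.inr) := rfl

/-- A product point lies in `U` of the glued graph iff both sides do. -/
lemma prodPt_mem (hg : IsGluing2 ends₁ ends₂ l h V₁ V₂) (b : β₁ × β₂)
    (ε : ι₁ b.1 ⊕ ι₂ b.2 → Bool) (h₁ : h ∉ hull ends₁ (pt₁ b.1 (ε ∘ Sum.inl)) l)
    (h₂ : h ∉ hull ends₂ (pt₂ b.2 (ε ∘ Sum.inr)) l) :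
    h ∉ hull (glue2 ends₁ ends₂) (prodPt pt₁ pt₂ b ε) l := by
  rw [notMem_hull_glue2_iff hg]
  exact ⟨h₁, h₂⟩

/-- The product of two monotone cube blocks mirroring the pair of `l` is a monotone cube block. -/
lemma cubeBlock_prod (hg : IsGluing2 ends₁ ends₂ l h V₁ V₂) (b : β₁ × β₂)
    (h₁ : CubeBlock ends₁ l h (pt₁ b.1)) (h₂ : CubeBlock ends₂ l h (pt₂ b.2))
    (hm : ((∀ ε, hullPair ends₁ (pt₁ b.1 (cubeNot ε)) l = (hullPair ends₁ (pt₁ b.1 ε) l).swap) ∧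
        (∀ ε, hullPair ends₂ (pt₂ b.2 (cubeNot ε)) l = (hullPair ends₂ (pt₂ b.2 ε) l).swap)) ∨
      ((∀ ε, hullPair ends₁ (pt₁ b.1 (cubeNot ε)) h = (hullPair ends₁ (pt₁ b.1 ε) h).swap) ∧
        (∀ ε, hullPair ends₂ (pt₂ b.2 (cubeNot ε)) h = (hullPair ends₂ (pt₂ b.2 ε) h).swap))) :
    CubeBlock (glue2 ends₁ ends₂) l h (prodPt pt₁ pt₂ b) := by
  have hmem : ∀ ε, h ∉ hull (glue2 ends₁ ends₂) (prodPt pt₁ pt₂ b ε) l :=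
    fun ε => prodPt_mem hg b ε (h₁.mem _) (h₂.mem _)
  have hl : ∀ ε, hullPair (glue2 ends₁ ends₂) (prodPt pt₁ pt₂ b ε) l =
      pairUnion (hullPair ends₁ (pt₁ b.1 (ε ∘ Sum.inl)) l)
        (hullPair ends₂ (pt₂ b.2 (ε ∘ Sum.inr)) l) := by
    intro ε
    rw [hullPair_glue2_l hg (hmem ε), prodPt_inl, prodPt_inr]
  have hh : ∀ ε, hullPair (glue2 ends₁ ends₂) (prodPt pt₁ pt₂ b ε) h =
      pairUnion (hullPair ends₁ (pt₁ b.1 (ε ∘ Sum.inl)) h)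
        (hullPair ends₂ (pt₂ b.2 (ε ∘ Sum.inr)) h) := by
    intro ε
    rw [hullPair_glue2_h hg (hmem ε), prodPt_inl, prodPt_inr]
  refine ⟨?_, hmem, ?_, ?_, ?_⟩
  · intro ε ε' hεε'
    have e1 := congrArg (fun ζ => ζ ∘ Sum.inl) hεε'
    have e2 := congrArg (fun ζ => ζ ∘ Sum.inr) hεε'
    simp only [prodPt_inl, prodPt_inr] at e1 e2
    have f1 := h₁.inj e1
    have f2 := h₂.inj e2
    funext j
    cases j with
    | inl j => exact congrFun f1 j
    | inr j => exact congrFun f2 j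
  · intro ε ε' hle
    rw [hl, hl]
    exact PairLE.union (h₁.l_mono (comp_inl_le hle)) (h₂.l_mono (comp_inr_le hle))
  · intro ε ε' hle
    rw [hh, hh]
    exact PairLE.union (h₁.h_anti (comp_inl_le hle)) (h₂.h_anti (comp_inr_le hle))
  · rcases hm with ⟨hm₁, hm₂⟩ | ⟨hm₁, hm₂⟩
    · left
      intro ε
      rw [hl, hl, cubeNot_comp_inl, cubeNot_comp_inr, hm₁, hm₂, pairUnion_swap]
    · right
      intro ε
      rw [hh, hh, cubeNot_comp_inl, cubeNot_comp_inr, hm₁, hm₂, pairUnion_swap]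

/-- **Cube covers compose in parallel** (both covers mirroring the pair of `l`). -/
theorem cubeCover_glue2 (hg : IsGluing2 ends₁ ends₂ l h V₁ V₂)
    (hc₁ : CubeCover ends₁ l h pt₁) (hc₂ : CubeCover ends₂ l h pt₂)
    (hm₁ : LMirror ends₁ l pt₁) (hm₂ : LMirror ends₂ l pt₂) :
    CubeCover (glue2 ends₁ ends₂) l h (prodPt pt₁ pt₂) := by
  refine ⟨fun b => cubeBlock_prod hg b (hc₁.block b.1) (hc₂.block b.2)
    (Or.inl ⟨hm₁ b.1, hm₂ b.2⟩), ?_, ?_⟩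
  · intro ζ hζ
    rw [notMem_hull_glue2_iff hg] at hζ
    obtain ⟨b₁, ε₁, he₁⟩ := hc₁.cover _ hζ.1
    obtain ⟨b₂, ε₂, he₂⟩ := hc₂.cover _ hζ.2
    refine ⟨(b₁, b₂), Sum.elim ε₁ ε₂, ?_⟩
    simp only [prodPt]
    have e1 : (Sum.elim ε₁ ε₂ ∘ Sum.inl : ι₁ b₁ → Bool) = ε₁ := rfl
    have e2 : (Sum.elim ε₁ ε₂ ∘ Sum.inr : ι₂ b₂ → Bool) = ε₂ := rfl
    rw [e1, e2, he₁, he₂, pair2_sides]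
  · intro b b' ε ε' heq
    have e1 := congrArg (fun ζ => ζ ∘ Sum.inl) heq
    have e2 := congrArg (fun ζ => ζ ∘ Sum.inr) heq
    simp only [prodPt_inl, prodPt_inr] at e1 e2
    exact Prod.ext (hc₁.disj _ _ _ _ e1) (hc₂.disj _ _ _ _ e2)

/-- **Cube covers compose in parallel** (both covers mirroring the pair of `h`). -/
theorem cubeCover_glue2_h (hg : IsGluing2 ends₁ ends₂ l h V₁ V₂)
    (hc₁ : CubeCover ends₁ l h pt₁) (hc₂ : CubeCover ends₂ l h pt₂)
    (hm₁ : HMirror ends₁ h pt₁) (hm₂ : HMirror ends₂ h pt₂) :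
    CubeCover (glue2 ends₁ ends₂) l h (prodPt pt₁ pt₂) := by
  refine ⟨fun b => cubeBlock_prod hg b (hc₁.block b.1) (hc₂.block b.2)
    (Or.inr ⟨hm₁ b.1, hm₂ b.2⟩), ?_, ?_⟩
  · intro ζ hζ
    rw [notMem_hull_glue2_iff hg] at hζ
    obtain ⟨b₁, ε₁, he₁⟩ := hc₁.cover _ hζ.1
    obtain ⟨b₂, ε₂, he₂⟩ := hc₂.cover _ hζ.2
    refine ⟨(b₁, b₂), Sum.elim ε₁ ε₂, ?_⟩
    simp only [prodPt]
    have e1 : (Sum.elim ε₁ ε₂ ∘ Sum.inl : ι₁ b₁ → Bool) = ε₁ := rfl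
    have e2 : (Sum.elim ε₁ ε₂ ∘ Sum.inr : ι₂ b₂ → Bool) = ε₂ := rfl
    rw [e1, e2, he₁, he₂, pair2_sides]
  · intro b b' ε ε' heq
    have e1 := congrArg (fun ζ => ζ ∘ Sum.inl) heq
    have e2 := congrArg (fun ζ => ζ ∘ Sum.inr) heq
    simp only [prodPt_inl, prodPt_inr] at e1 e2
    exact Prod.ext (hc₁.disj _ _ _ _ e1) (hc₂.disj _ _ _ _ e2)

/-- The mirror property of the product (on `l`). -/
lemma lMirror_prod (hg : IsGluing2 ends₁ ends₂ l h V₁ V₂) (hc₁ : CubeCover ends₁ l h pt₁)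
    (hc₂ : CubeCover ends₂ l h pt₂) (hm₁ : LMirror ends₁ l pt₁) (hm₂ : LMirror ends₂ l pt₂) :
    LMirror (glue2 ends₁ ends₂) l (prodPt pt₁ pt₂) := by
  intro b ε
  have hmem : ∀ ε, h ∉ hull (glue2 ends₁ ends₂) (prodPt pt₁ pt₂ b ε) l :=
    fun ε => prodPt_mem hg b ε ((hc₁.block b.1).mem _) ((hc₂.block b.2).mem _)
  rw [hullPair_glue2_l hg (hmem _), hullPair_glue2_l hg (hmem _), prodPt_inl, prodPt_inr,
    prodPt_inl, prodPt_inr, cubeNot_comp_inl, cubeNot_comp_inr, hm₁, hm₂, pairUnion_swap]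

end Blocks

end Summit.Ventures.PercRepro2
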